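import Literature.NumberTheory.Sieve.HeathBrownCubicLemma81
import Literature.NumberTheory.Sieve.HeathBrownCubicMoebiusSigma
import Literature.NumberTheory.LFunctions.IdealMoebiusCoprimeRpow
import Literature.NumberTheory.NumberFields.IdealTotient
import HarnessLib

/-!
# Heath-Brown's Lemma 8.1 for `x³ + 2y³`, unconditionally; Lemma 3.8 from Lemma 9.2 alone

D. R. Heath-Brown, *Primes represented by `x³ + 2y³`*, Acta Math. 186 (2001), 1–84, §8.
`HeathBrownCubicLemma81` proves Lemma 8.1 (the Siegel–Walfisz property of the `e`-terms) up to the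
hypothesis `hMS`: the evaluation, uniformly for `q ≥ 1`, `q³ ≤ x`, of the Möbius sums
`Σ(x; q) = ∑_{N(A) < x, (A, q) = 1} μ(A) log(x/N(A))/N(A) = q³/(γ₀ φ_K(q)) + O(exp(−c√(log x)))` (p. 51).
This file DISCHARGES `hMS` (`HeathBrown2001_moebiusSum_MS`) and records the consequences
`HeathBrown2001_lemma_8_1` (Lemma 8.1 as consumed by `HeathBrown2001_lemma_3_8_of`) and
`HeathBrown2001_lemma_3_8_of_lemma92` (Lemma 3.8 from Lemma 9.2 alone).

The Möbius sums are evaluated in `Literature.NumberTheory.LFunctions` for every number field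
(`coprimeMoebius_logRieszMean_bound_rpow`, Perron's formula for logarithmic Riesz means and the classical
zero-free region of `ζ_K`), with the numerator `∏_{P ∣ 𝔠}(1 − N(P)^{-s})^{-1}` bounded on `Re s = 3/4`; this
gives the factor `exp(M ∑_{p ∣ q} p^{-3/4})`, and Heath-Brown's remark (p. 51)
"`∏_{P∣C}(1 + N(P)^{-σ-1}) ≪ exp{c(log N(C))^{1/4}}`" is the elementary `sum_primeFactors_rpow_le`:
`∑_{p ∣ q} p^{-3/4} ≤ (4 + 1/log 2)(1 + log q)^{1/4}`, which is absorbed by `exp(−c√(log x))` for `q ≤ x`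
(`exp_quarter_mul_exp_neg_sqrt_le`). The residue `γ₀⁻¹∏_{P ∣ (q)}(1 − N(P)⁻¹)⁻¹` is `q³/(γ₀ φ_K(q))` by
`Literature.NumberTheory.NumberFields.absNorm_div_natCard_units_eq_prod` (`prod_normalizedFactors_span_eq`).

## Contents

* `sum_Icc_rpow_neg_le` (`∑_{n ≤ N} n^{-3/4} ≤ 4N^{1/4}`), `card_primeFactors_mul_log_two_le`
  (`ω(q) log 2 ≤ log q`), `sum_primeFactors_rpow_le`, `exp_quarter_mul_exp_neg_sqrt_le`;
* `prod_normalizedFactors_span_eq` — `∏_{P ∣ (q)}(1 − N(P)⁻¹)⁻¹ = q³/φ_K(q)`;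
* **`HeathBrown2001_moebiusSum_MS`** — `|Σ(x; q) − q³/(γ₀φ_K(q))| ≤ C_M exp(−c_M√(log x))` for `x ≥ 2`,
  `1 ≤ q`, `q³ ≤ x`;
* **`HeathBrown2001_lemma_8_1`**, **`HeathBrown2001_lemma_3_8_of_lemma92`**.

## References

* D. R. Heath-Brown, *Primes represented by `x³ + 2y³`*, Acta Math. 186 (2001), 1–84: Lemma 8.1 and
  p. 51; Lemma 3.8. [cite: HeathBrownActa2001, Lemma 8.1, §8 p. 51]

## Mathlib / tree search

Tree: `HeathBrown2001_lemma_8_1_of_MS`, `HeathBrown2001_lemma_3_8_of_MS` (`HeathBrownCubicLemma81`),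
`sigmaSum_eq_sum_Icc` (`HeathBrownCubicMoebiusSigma`), `coprimeMoebius_logRieszMean_bound_rpow`
(`IdealMoebiusCoprimeRpow`), `absNorm_div_natCard_units_eq_prod` (`NumberFields/IdealTotient`),
`absNorm_span_natCast_K`, `eulerPhiK`, `gamma₀`. Mathlib: `Nat.prod_primeFactors_dvd`,
`Finset.pow_card_le_prod`, `Nat.primeFactors_pow`, `factors_eq_normalizedFactors`, `Finset.sum_Icc_succ_top`.
-/

noncomputable section

open NumberField Finset UniqueFactorizationMonoid

namespace Literature.NumberTheory.Sieve.CubicSieve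

open LFunctions.CubeRootTwoField CubicPrimes LFunctions.NumberField

/-! ### Elementary inequalities -/

section Elementary

/-- `∑_{n=1}^{N} n^{-3/4} ≤ 4N^{1/4}` (induction: `4(N+1)^{1/4} − 4N^{1/4} ≥ (N+1)^{-3/4}`). [folklore] -/
theorem sum_Icc_rpow_neg_le (N : ℕ) :
    ∑ n ∈ Finset.Icc 1 N, (n : ℝ) ^ (-(3 / 4 : ℝ)) ≤ 4 * (N : ℝ) ^ (1 / 4 : ℝ) := by
  induction N with
  | zero => simp
  | succ N ih =>
    rw [Finset.sum_Icc_succ_top (by omega)]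
    push_cast
    have hN0 : (0 : ℝ) ≤ N := Nat.cast_nonneg N
    have hN1 : (0 : ℝ) < (N : ℝ) + 1 := by linarith
    set a : ℝ := ((N : ℝ) + 1) ^ (1 / 4 : ℝ) with ha
    set b : ℝ := (N : ℝ) ^ (1 / 4 : ℝ) with hb
    have ha0 : 0 < a := Real.rpow_pos_of_pos hN1 _
    have hb0 : 0 ≤ b := Real.rpow_nonneg hN0 _
    have hba : b ≤ a := Real.rpow_le_rpow hN0 (by linarith) (by norm_num)
    have ha4 : a ^ 4 = (N : ℝ) + 1 := by
      rw [ha, ← Real.rpow_natCast, ← Real.rpow_mul hN1.le]; norm_num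
    have hb4 : b ^ 4 = (N : ℝ) := by
      rw [hb, ← Real.rpow_natCast, ← Real.rpow_mul hN0]; norm_num
    have hneg : ((N : ℝ) + 1) ^ (-(3 / 4 : ℝ)) = (a ^ 3)⁻¹ := by
      rw [Real.rpow_neg hN1.le, ha, ← Real.rpow_natCast, ← Real.rpow_mul hN1.le]; norm_num
    rw [hneg]
    -- `4b + a⁻³ ≤ 4a` from `a⁴ − b⁴ = 1 ≤ 4a³(a − b)`
    have hkey : 1 ≤ 4 * a ^ 3 * (a - b) := by
      have h1 : a ^ 4 - b ^ 4 = 1 := by rw [ha4, hb4]; ring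
      have h2 : 4 * a ^ 3 * (a - b) - (a ^ 4 - b ^ 4) =
          (a - b) * (a ^ 2 * (a - b) + a * ((a - b) * (a + b)) + (a - b) * (a ^ 2 + a * b + b ^ 2)) := by
        ring
      have hab : 0 ≤ a - b := sub_nonneg.2 hba
      have h3 : 0 ≤ (a - b) * (a ^ 2 * (a - b) + a * ((a - b) * (a + b)) +
          (a - b) * (a ^ 2 + a * b + b ^ 2)) := by positivity
      linarith
    have ha3 : 0 < a ^ 3 := by positivity
    calc ∑ k ∈ Finset.Icc 1 N, (k : ℝ) ^ (-(3 / 4 : ℝ)) + (a ^ 3)⁻¹ ≤ 4 * b + (a ^ 3)⁻¹ :=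
          add_le_add ih le_rfl
      _ = (4 * b * a ^ 3 + 1) / a ^ 3 := by field_simp
      _ ≤ (4 * a * a ^ 3) / a ^ 3 := by
          apply div_le_div_of_nonneg_right _ ha3.le
          nlinarith
      _ = 4 * a := by field_simp

/-- `ω(q) log 2 ≤ log q`: `2^{ω(q)} ≤ ∏_{p ∣ q} p ≤ q`. [folklore] -/
theorem card_primeFactors_mul_log_two_le (q : ℕ) : (q.primeFactors.card : ℝ) * Real.log 2 ≤ Real.log q := by
  rcases eq_or_ne q 0 with rfl | hq
  · simp
  have h1 : 2 ^ q.primeFactors.card ≤ ∏ p ∈ q.primeFactors, p :=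
    Finset.pow_card_le_prod _ _ 2 fun p hp ↦ (Nat.prime_of_mem_primeFactors hp).two_le
  have h2 : ∏ p ∈ q.primeFactors, p ≤ q := Nat.le_of_dvd (Nat.pos_of_ne_zero hq) (Nat.prod_primeFactors_dvd q)
  have h3 : ((2 : ℝ)) ^ q.primeFactors.card ≤ (q : ℝ) := by exact_mod_cast h1.trans h2
  rw [← Real.log_pow]
  exact Real.log_le_log (by positivity) h3

/-- **`∑_{p ∣ q} p^{-3/4} ≤ (4 + 1/log 2)(1 + log q)^{1/4}`** (Heath-Brown p. 51:
"`∏_{P∣C}(…) ≪ exp{c(log N(C))^{1/4}}`"): the primes `p ≤ y = 1 + log q` contribute at most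
`∑_{n ≤ y} n^{-3/4} ≤ 4y^{1/4}`, the `≤ ω(q) ≤ log q/log 2` others at most `y^{-3/4}` each. [folklore] -/
theorem sum_primeFactors_rpow_le (q : ℕ) :
    ∑ p ∈ q.primeFactors, (p : ℝ) ^ (-(3 / 4 : ℝ)) ≤
      (4 + (Real.log 2)⁻¹) * (1 + Real.log q) ^ (1 / 4 : ℝ) := by
  have hlog2 : 0 < Real.log 2 := Real.log_pos one_lt_two
  have hlq : 0 ≤ Real.log q := Real.log_natCast_nonneg q
  set y : ℝ := 1 + Real.log q with hy
  have hy1 : 1 ≤ y := by linarith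
  have hy0 : 0 < y := by linarith
  set N : ℕ := ⌊y⌋₊ with hN
  have hNy : (N : ℝ) ≤ y := Nat.floor_le hy0.le
  have hyN : y < (N : ℝ) + 1 := Nat.lt_floor_add_one y
  set f : ℕ → ℝ := fun p ↦ (p : ℝ) ^ (-(3 / 4 : ℝ)) with hf
  have hf0 : ∀ p, 0 ≤ f p := fun p ↦ Real.rpow_nonneg (Nat.cast_nonneg p) _
  rw [← Finset.sum_filter_add_sum_filter_not q.primeFactors (fun p ↦ p ≤ N)]
  -- small primes
  have hsmall : ∑ p ∈ q.primeFactors.filter (fun p ↦ p ≤ N), f p ≤ 4 * y ^ (1 / 4 : ℝ) := by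
    calc ∑ p ∈ q.primeFactors.filter (fun p ↦ p ≤ N), f p ≤ ∑ n ∈ Finset.Icc 1 N, f n := by
          refine Finset.sum_le_sum_of_subset_of_nonneg (fun p hp ↦ ?_) fun n _ _ ↦ hf0 n
          rw [Finset.mem_filter] at hp
          rw [Finset.mem_Icc]
          exact ⟨(Nat.prime_of_mem_primeFactors hp.1).one_lt.le, hp.2⟩
      _ ≤ 4 * (N : ℝ) ^ (1 / 4 : ℝ) := sum_Icc_rpow_neg_le N
      _ ≤ 4 * y ^ (1 / 4 : ℝ) := by gcongr
  -- large primes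
  have hlarge : ∑ p ∈ q.primeFactors.filter (fun p ↦ ¬p ≤ N), f p ≤ (Real.log 2)⁻¹ * y ^ (1 / 4 : ℝ) := by
    have hterm : ∀ p ∈ q.primeFactors.filter (fun p ↦ ¬p ≤ N), f p ≤ y ^ (-(3 / 4 : ℝ)) := by
      intro p hp
      rw [Finset.mem_filter, not_le] at hp
      have hpy : y ≤ p := by
        have : (N : ℝ) + 1 ≤ p := by exact_mod_cast hp.2
        linarith
      exact Real.rpow_le_rpow_of_nonpos hy0 hpy (by norm_num)
    have hcard : ((q.primeFactors.filter (fun p ↦ ¬p ≤ N)).card : ℝ) ≤ (Real.log 2)⁻¹ * y := by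
      calc ((q.primeFactors.filter (fun p ↦ ¬p ≤ N)).card : ℝ) ≤ q.primeFactors.card := by
            exact_mod_cast Finset.card_filter_le _ _
        _ ≤ (Real.log 2)⁻¹ * Real.log q := by
            rw [le_inv_mul_iff₀ hlog2, mul_comm]
            exact card_primeFactors_mul_log_two_le q
        _ ≤ (Real.log 2)⁻¹ * y := by gcongr; linarith
    calc ∑ p ∈ q.primeFactors.filter (fun p ↦ ¬p ≤ N), f p
        ≤ ∑ _p ∈ q.primeFactors.filter (fun p ↦ ¬p ≤ N), y ^ (-(3 / 4 : ℝ)) := Finset.sum_le_sum hterm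
      _ = ((q.primeFactors.filter (fun p ↦ ¬p ≤ N)).card : ℝ) * y ^ (-(3 / 4 : ℝ)) := by
          rw [Finset.sum_const, nsmul_eq_mul]
      _ ≤ (Real.log 2)⁻¹ * y * y ^ (-(3 / 4 : ℝ)) :=
          mul_le_mul_of_nonneg_right hcard (Real.rpow_nonneg hy0.le _)
      _ = (Real.log 2)⁻¹ * y ^ (1 / 4 : ℝ) := by
          rw [mul_assoc]
          congr 1
          conv_lhs => rw [show y * y ^ (-(3 / 4 : ℝ)) = y ^ (1 : ℝ) * y ^ (-(3 / 4 : ℝ)) by rw [Real.rpow_one]]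
          rw [← Real.rpow_add hy0]
          norm_num
  calc _ ≤ 4 * y ^ (1 / 4 : ℝ) + (Real.log 2)⁻¹ * y ^ (1 / 4 : ℝ) := add_le_add hsmall hlarge
    _ = (4 + (Real.log 2)⁻¹) * y ^ (1 / 4 : ℝ) := by ring

/-- **Absorbing `exp(a(1 + u)^{1/4})` into `exp(−c√u)`**: for real `a`, `c > 0`, `u ≥ 0`,
`exp(a(1+u)^{1/4}) exp(−c√u) ≤ exp(a²/(2c) + c/2) exp(−(c/2)√u)` (with `w = (1+u)^{1/4}`:
`√u ≥ w² − 1` and `aw − (c/2)w² ≤ a²/(2c)`). [folklore] -/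
theorem exp_quarter_mul_exp_neg_sqrt_le (a : ℝ) {c u : ℝ} (hc : 0 < c) (hu : 0 ≤ u) :
    Real.exp (a * (1 + u) ^ (1 / 4 : ℝ)) * Real.exp (-c * Real.sqrt u) ≤
      Real.exp (a ^ 2 / (2 * c) + c / 2) * Real.exp (-(c / 2) * Real.sqrt u) := by
  rw [← Real.exp_add, ← Real.exp_add, Real.exp_le_exp]
  have hu1 : 0 < 1 + u := by linarith
  set w : ℝ := (1 + u) ^ (1 / 4 : ℝ) with hw
  have hw2 : w ^ 2 = Real.sqrt (1 + u) := by
    rw [hw, ← Real.rpow_natCast, ← Real.rpow_mul hu1.le, Real.sqrt_eq_rpow]; norm_num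
  have hsqrt : Real.sqrt (1 + u) ≤ Real.sqrt u + 1 := by
    rw [Real.sqrt_le_left (by positivity)]
    nlinarith [Real.sq_sqrt hu, Real.sqrt_nonneg u]
  have hsu : w ^ 2 - 1 ≤ Real.sqrt u := by rw [hw2]; linarith
  have hkey : a * w - c / 2 * w ^ 2 ≤ a ^ 2 / (2 * c) := by
    have h : a ^ 2 / (2 * c) - (a * w - c / 2 * w ^ 2) = (a - c * w) ^ 2 / (2 * c) := by
      field_simp
      ring
    have h' : 0 ≤ (a - c * w) ^ 2 / (2 * c) := by positivity
    linarith
  nlinarith [hc.le]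

end Elementary

/-! ### The residue `γ₀⁻¹ N(q)/φ_K(q)` -/

section Residue

/-- **`∏_{P ∣ (q)}(1 − N(P)⁻¹)⁻¹ = q³/φ_K(q)`** for `q ≥ 1` (`N((q)) = q³`, `φ_K(q) = #(𝓞_K/(q))ˣ`;
`NumberFields.absNorm_div_natCard_units_eq_prod`). [cite: HeathBrownActa2001, §8 p. 51] -/
theorem prod_normalizedFactors_span_eq {q : ℕ} (hq : 1 ≤ q) :
    ∏ P ∈ (normalizedFactors (Ideal.span {(q : 𝓞 K)})).toFinset, (1 - (Ideal.absNorm P : ℝ)⁻¹)⁻¹ =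
      (q : ℝ) ^ 3 / eulerPhiK q := by
  have hN := absNorm_span_natCast_K q
  have h𝔮0 : Ideal.span {(q : 𝓞 K)} ≠ ⊥ := by
    intro h
    rw [h, Ideal.absNorm_bot] at hN
    have : 0 < q ^ 3 := pow_pos hq 3
    omega
  have h := Literature.NumberTheory.NumberFields.absNorm_div_natCard_units_eq_prod (S := 𝓞 K) h𝔮0
  rw [factors_eq_normalizedFactors] at h
  rw [← h, hN, eulerPhiK]
  push_cast
  rfl

end Residue

/-! ### The Möbius sums `Σ(x; q)` (hypothesis `hMS` of `HeathBrown2001_lemma_8_1_of_MS`) -/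

section MoebiusSums

open scoped Classical in
/-- **Heath-Brown's evaluation of `Σ(x; q)` (p. 51), uniformly for `q³ ≤ x`**: there are `C_M` and
`c_M > 0` such that for all real `x ≥ 2` and all `q ≥ 1` with `q³ ≤ x`,
`|∑_{N(A) < x, (A, q) = 1} μ(A) log(x/N(A))/N(A) − q³/(γ₀ φ_K(q))| ≤ C_M exp(−c_M √(log x))`
("`Σ = res{f(s+1)x^s s^{-2} : s = 0} + O(exp{−c√(log x)})` … whenever `N(C) ≤ x`. The residue is easily found
to be `γ₀⁻¹∏_{P∣C}(1 − N(P)⁻¹)⁻¹` … the main term is `γ₀⁻¹N(q)/φ_K(q)`"). This is exactly the hypothesis `hMS`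
of `HeathBrown2001_lemma_8_1_of_MS`. [cite: HeathBrownActa2001, §8 p. 51] -/
theorem HeathBrown2001_moebiusSum_MS :
    ∃ C_M c_M : ℝ, 0 < c_M ∧ ∀ x : ℝ, 2 ≤ x → ∀ q : ℕ, 1 ≤ q → (q : ℝ) ^ 3 ≤ x →
      |∑ A ∈ (smallIdeals x).filter (fun A => A ⊔ Ideal.span {(q : 𝓞 K)} = ⊤),
          idealMoebius A * Real.log (x / Ideal.absNorm A) / Ideal.absNorm A -
        (q : ℝ) ^ 3 / (gamma₀ * eulerPhiK q)| ≤ C_M * Real.exp (-(c_M * Real.sqrt (Real.log x))) := by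
  classical
  obtain ⟨c, hc, C, hC, M, hM0, h⟩ :=
    coprimeMoebius_logRieszMean_bound_rpow (K := K) (σ := 3 / 4) (by norm_num) (by norm_num)
  set κ : ℝ := 4 + (Real.log 2)⁻¹ with hκ
  have hκ0 : 0 ≤ κ := by
    have : 0 < Real.log 2 := Real.log_pos one_lt_two
    positivity
  set a : ℝ := M * κ with hadef
  refine ⟨C * Real.exp (a ^ 2 / (2 * c) + c / 2), c / 2, half_pos hc, fun x hx q hq hqx ↦ ?_⟩
  set 𝔮 : Ideal (𝓞 K) := Ideal.span {(q : 𝓞 K)} with h𝔮def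
  have hN : Ideal.absNorm 𝔮 = q ^ 3 := absNorm_span_natCast_K q
  have h𝔮0 : 𝔮 ≠ ⊥ := by
    intro h0
    rw [h0, Ideal.absNorm_bot] at hN
    have : 0 < q ^ 3 := pow_pos hq 3
    omega
  have hx1 : (1 : ℝ) ≤ x := by linarith
  have key := h 𝔮 h𝔮0 x hx1
  -- the complex statement is a real one
  have hcast : (∑ n ∈ Finset.Icc 1 ⌊x⌋₊,
      ((∑ B ∈ (idealsOfNorm K n).filter (fun B ↦ B ⊔ 𝔮 = ⊤), LFunctions.idealMoebius B : ℤ) : ℂ) / n *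
        (Real.log (x / n) : ℂ)) -
      ((∏ P ∈ (normalizedFactors 𝔮).toFinset, (1 - (Ideal.absNorm P : ℝ)⁻¹)⁻¹ : ℝ) : ℂ) /
        (NumberField.dedekindZeta_residue K : ℂ) =
      (((∑ n ∈ Finset.Icc 1 ⌊x⌋₊,
        ((∑ B ∈ (idealsOfNorm K n).filter (fun B ↦ B ⊔ 𝔮 = ⊤), LFunctions.idealMoebius B : ℤ) : ℝ) *
          (Real.log (x / n) / n)) -
        gamma₀⁻¹ * ∏ P ∈ (normalizedFactors 𝔮).toFinset, (1 - (Ideal.absNorm P : ℝ)⁻¹)⁻¹ : ℝ) : ℂ) := by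
    rw [gamma₀]
    push_cast
    congr 1
    · refine Finset.sum_congr rfl fun n _ ↦ ?_
      ring
    · ring
  rw [hcast, Complex.norm_real, Real.norm_eq_abs, ← sigmaSum_eq_sum_Icc, prod_normalizedFactors_span_eq hq,
    hN, Nat.primeFactors_pow q three_ne_zero] at key
  have hmain : gamma₀⁻¹ * ((q : ℝ) ^ 3 / eulerPhiK q) = (q : ℝ) ^ 3 / (gamma₀ * eulerPhiK q) := by
    rw [div_mul_eq_div_div, ← inv_mul_eq_div]
    ring
  rw [hmain] at key
  refine key.trans ?_
  -- the Euler factor: `exp(M ∑_{p ∣ q} p^{-3/4}) ≤ exp(a (1 + log x)^{1/4})`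
  have hq0 : (0 : ℝ) < q := by exact_mod_cast hq
  have hqx1 : (q : ℝ) ≤ x := by
    calc (q : ℝ) = (q : ℝ) ^ 1 := (pow_one _).symm
      _ ≤ (q : ℝ) ^ 3 := pow_le_pow_right₀ (by exact_mod_cast hq) (by norm_num)
      _ ≤ x := hqx
  have hlogx : 0 ≤ Real.log x := Real.log_nonneg hx1
  have hE : Real.exp (M * ∑ p ∈ q.primeFactors, (p : ℝ) ^ (-(3 / 4 : ℝ))) ≤
      Real.exp (a * (1 + Real.log x) ^ (1 / 4 : ℝ)) := by
    rw [Real.exp_le_exp, hadef, mul_assoc]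
    refine mul_le_mul_of_nonneg_left ((sum_primeFactors_rpow_le q).trans ?_) hM0
    refine mul_le_mul_of_nonneg_left (Real.rpow_le_rpow (by positivity) ?_ (by norm_num)) hκ0
    linarith [Real.log_le_log hq0 hqx1]
  have habs := exp_quarter_mul_exp_neg_sqrt_le a hc hlogx
  calc C * Real.exp (M * ∑ p ∈ q.primeFactors, (p : ℝ) ^ (-(3 / 4 : ℝ))) * Real.exp (-c * Real.sqrt (Real.log x))
      ≤ C * Real.exp (a * (1 + Real.log x) ^ (1 / 4 : ℝ)) * Real.exp (-c * Real.sqrt (Real.log x)) := by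
        gcongr
    _ = C * (Real.exp (a * (1 + Real.log x) ^ (1 / 4 : ℝ)) * Real.exp (-c * Real.sqrt (Real.log x))) := by ring
    _ ≤ C * (Real.exp (a ^ 2 / (2 * c) + c / 2) * Real.exp (-(c / 2) * Real.sqrt (Real.log x))) :=
        mul_le_mul_of_nonneg_left habs hC.le
    _ = C * Real.exp (a ^ 2 / (2 * c) + c / 2) * Real.exp (-(c / 2 * Real.sqrt (Real.log x))) := by
        rw [neg_mul]; ring

end MoebiusSums

/-! ### Lemma 8.1 and Lemma 3.8 -/

section Main

/-- **Heath-Brown's Lemma 8.1, PROVED** (the `e`-terms have the Siegel–Walfisz property of Lemma 3.8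
uniformly for `q ≤ L^{1/6}`): "Let `L² ≤ S₀` and suppose that `q ≤ L^{1/6}`. Then for any positive constant
`c` we have `∑_{s ∈ 𝒞, s ≡ α mod q} e_s = ε(α, q) γ₀⁻¹ φ_K(q)⁻¹ (∏ μ_i)⁻¹ (ξ log X)^{-n} 𝓘 + O(S₀³(∏ μ_i)⁻¹ exp{−c√(log L)})`",
in the form `h81` consumed by `HeathBrown2001_lemma_3_8_of` (with `τ(q)^{c'}`, `c' = 0`):
`HeathBrown2001_lemma_8_1_of_MS` with its hypothesis discharged by `HeathBrown2001_moebiusSum_MS`.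
[cite: HeathBrownActa2001, Lemma 8.1] -/
theorem HeathBrown2001_lemma_8_1 :
    ∀ ϖ : ℝ, 0 < ϖ → ϖ < 1 / 5 → ∀ c₃ c₄ : ℝ, 0 < c₃ → 0 < c₄ →
      ∃ C c c' X₀ : ℝ, 0 < c ∧ ∀ X : ℝ, X₀ ≤ X → ∀ (k : ℕ) (m : Fin k → ℕ),
        CoreAdmissible (hbTau ϖ X) m →
          ∀ q : ℕ, 1 ≤ q → (q : ℝ) ≤ hbL X (hbTau ϖ X) ^ (1 / 6 : ℝ) →
            ∀ (α : 𝓞 K) (V : ℝ) (a : ℝ × ℝ × ℝ) (S₀ : ℝ), 0 < V →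
              hbL X (hbTau ϖ X) ^ 2 ≤ S₀ → CubeCond c₃ c₄ V a S₀ →
                |cubeClassSum (eWeight X (hbTau ϖ X) m) q α a S₀ -
                    coprimeInd α q * swMainTerm X (hbTau ϖ X) m q a S₀| ≤
                  C * S₀ ^ 3 * (∏ i, (m i : ℝ))⁻¹ * ((Nat.divisors q).card : ℝ) ^ c' *
                    Real.exp (-(c * Real.sqrt (Real.log (hbL X (hbTau ϖ X))))) :=
  HeathBrown2001_lemma_8_1_of_MS HeathBrown2001_moebiusSum_MS

/-- **Heath-Brown's Lemma 3.8 from Lemma 9.2 alone**: with Lemma 8.1 (`HeathBrown2001_lemma_8_1`) and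
Lemma 9.1 (`HeathBrown2001_lemma_9_1`) theorems of the tree, the glue `HeathBrown2001_lemma_3_8_of` leaves
exactly one analytic input — Lemma 9.2, the Siegel–Walfisz theorem for the `d`-terms (Hecke
Grössencharaktere and Mitsui's prime ideal theorem, §9), taken here as the hypothesis `h92` verbatim.
[cite: HeathBrownActa2001, Lemma 3.8] -/
theorem HeathBrown2001_lemma_3_8_of_lemma92
    (h92 : ∀ ϖ : ℝ, 0 < ϖ → ϖ < 1 / 5 → ∀ A : ℕ, 0 < A → ∀ c₃ c₄ : ℝ, 0 < c₃ → 0 < c₄ →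
      ∃ C c X₀ : ℝ, 0 < c ∧ ∀ X : ℝ, X₀ ≤ X → ∀ (k : ℕ) (m : Fin k → ℕ),
        CoreAdmissible (hbTau ϖ X) m →
          ∀ q : ℕ, 1 ≤ q → (q : ℝ) ≤ Real.log (hbL X (hbTau ϖ X)) ^ A →
            ∀ α : 𝓞 K, IsCoprime α (q : 𝓞 K) →
              ∀ (V : ℝ) (a : ℝ × ℝ × ℝ) (S₀ : ℝ), 0 < V →
                hbL X (hbTau ϖ X) ^ 2 ≤ S₀ → CubeCond c₃ c₄ V a S₀ →
                  |cubeClassSum (dWeight X (hbTau ϖ X) m) q α a S₀ -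
                      swMainTerm X (hbTau ϖ X) m q a S₀| ≤
                    C * V * Real.exp (-(c * Real.sqrt (Real.log (hbL X (hbTau ϖ X)))))) :
    HeathBrown2001_lemma_3_8 :=
  HeathBrown2001_lemma_3_8_of_MS HeathBrown2001_moebiusSum_MS h92

end Main

end Literature.NumberTheory.Sieve.CubicSieve

end
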